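import Literature.AlgebraicGeometry.HodgeTheory.BettiHodgeConjectureSurfaceTimesThreefoldOddKunneth
import Literature.AlgebraicGeometry.HodgeTheory.AlgebraicClassesCupDivisorHolds
import Literature.AlgebraicGeometry.HodgeTheory.BettiNumbersEulerCharacteristic
import HarnessLib

/-!
# Hard Lefschetz reduces the Hodge conjecture for `Y × Z` to the Künneth pieces `Hⁱ(Y) ⊗ Hʲ(Z)` with `i ≤ dim Y`, `j ≤ dim Z` — unconditionally; the pieces `H¹(Y) ⊗ H^{2n−1}(Z)` are algebraic
# (Voisin I Thm. 6.25, Rem. 6.27, Lemma 7.23, Thm. 11.38–11.40, p. 287, Thm. 11.30; Voisin II Prop. 9.20 for a divisor)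

Family `hodge`, lane `lit-hodgefound` (Track 2 foundations library; Layers A2/A4), layer `Literature/AlgebraicGeometry/HodgeTheory`.  THEOREMS ONLY (no definition, no named fact, no instance;
D-0026 net debt `0`).  Sequel of the seat's g28-#1 (`BettiHardLefschetzHodgeMorphisms`: `Lᵗ_η : Hᵏ(X) → H^{k+2t}(X)(t)` is a morphism of `ℚ`-Hodge structures, bijective for `k + t = dim X`), g28-#7 (the cup
identity `crossMap ((id ⊗ L) u) = pr₂^* η ∪ crossMap u` on `H¹ ⊗ H¹`) and g29-#1 (`BettiHodgeConjectureProductsWithSurfaceUnconditional`: the cup product with a divisor class preserves algebraic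
classes — a theorem of the tree, `cupProduct_mem_algebraicClasses_of_min_le_one` / `lefschetzOperator_mem_algebraicClasses_of_mem` of `AlgebraicClassesCupDivisorHolds`).  Free pointer (b) of the
seat's gen-28 HANDOFF: the general odd pieces `H¹(Y) ⊗ H^{2n−1}(Z)` via `L^{n−1}`.

THE MATHEMATICS.  Let `Y`, `Z` be smooth projective of dimensions `m`, `n`, `η` a rational Kähler class on `Z`, and `Hⁱ(Y) ⊗ Hʲ(Z) ⊂ H^{i+j}(Y × Z)` a Künneth piece (a sub-Hodge structure, Thm. 11.40)
with `j = j₀ + 2s`, `j₀ + s = n` (i.e. `j ≥ n`, `j₀ = 2n − j`).  Hard Lefschetz `Lˢ_η : H^{j₀}(Z) ⥲ Hʲ(Z)(s)` is an ISOMORPHISM of `ℚ`-Hodge structures (Thm. 6.25 + Rem. 6.27 + Lemma 7.23), hence so is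
`id ⊗ Lˢ_η : Hⁱ(Y) ⊗ H^{j₀}(Z) ⥲ (Hⁱ(Y) ⊗ Hʲ(Z))(s)`, which therefore carries the Hodge classes `Hdg^{c−s}` of the source ONTO the Hodge classes `Hdg^c` of `Hⁱ(Y) ⊗ Hʲ(Z)` (`i + j = 2c`).  On the other
hand `pr₁^* a ∪ pr₂^*(ηˢ ∪ b) = (pr₂^* η)ˢ ∪ (pr₁^* a ∪ pr₂^* b)` (naturality, associativity and graded commutativity of `∪` — `η` has even degree), i.e. `crossMap ∘ (id ⊗ Lˢ_η) = Lˢ_{pr₂^* η} ∘ crossMap`,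
and the Lefschetz operator of the divisor class `pr₂^* η` maps algebraic classes to algebraic classes (`[Z] ↦ [H · Z]`, Prop. 9.20 for a divisor — a theorem of the tree).  HENCE: if the Hodge classes of
the piece `Hⁱ(Y) ⊗ H^{2n−j}(Z)` map to algebraic classes of `Y × Z`, so do those of `Hⁱ(Y) ⊗ Hʲ(Z)`; symmetrically in the first factor.  Since the Hodge classes of `H^{2c}(Y × Z)` are the sums of cross
products of Hodge classes of the pieces (Thm. 11.38/11.40 + Lemma 7.23, the lane's `exists_eq_kunnethMap_of_mem_hodgeClasses`), **the Hodge conjecture for `Y × Z` follows from the algebraicity of the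
Hodge classes of the pieces `Hⁱ(Y) ⊗ Hʲ(Z)` with `i ≤ m` and `j ≤ n` only** — and among those, the pieces with `i = 0` or `j = 0` are governed by `HC(Z)`, `HC(Y)`, and the pieces of total degree `2`
are divisor classes (Lefschetz `(1,1)`).  Example: `H¹(Y) ⊗ H^{2n−1}(Z) ⊂ H^{2n}(Y × Z)` reduces to `H¹(Y) ⊗ H¹(Z) ⊂ H²(Y × Z)`, divisor classes: **the Hodge classes of `H¹(Y) ⊗ H^{2n−1}(Z)` are algebraic
for all smooth projective `Y`, `Z`** (they are the classes `(pr₂^* η)^{n−1} ∪ D`, `D` a divisor class; in terms of abelian varieties, `Hom(Alb Y, Alb Z)`-classes).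

THE PRINTS.  C. Voisin (2002) [VoisinHodgeI2002] §6.2.3 Thm. 6.25, Cor. 6.26, Rem. 6.27 (hard Lefschetz, `L` of bidegree `(1,1)`); §7.3.1 Def. 7.22, Lemma 7.23 (strictness: a bijective morphism is
an isomorphism of Hodge structures); §11.3.3 Thm. 11.38, Def. 11.39, Thm. 11.40, Lemma 11.41, p. 287 (Künneth; the Hodge classes of a product); §11.3.1 Thm. 11.30 (Lefschetz `(1,1)`); §11.3.2 (the
conjecture; codimensions `≤ 1`, `≥ n − 1`).  C. Voisin (2003) [VoisinHodgeII2003] §9.2.4 Prop. 9.20 (`cl(Z · Z') = cl(Z) ∪ cl(Z')`).  C. Voisin (2013) [Voisin2013GHCBloch] Lemma 2.1 (proof).  P. Deligne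
(1971) [DeligneHodgeII1971] 1.1.12, 2.1.13–2.1.14 (tensor products, Tate twists).  P. Deligne (2000) [Deligne2000] §1.  A. Hatcher (2002) [HatcherAT2002] §3.2 Prop. 3.10, Thm. 3.11, Thm. 3.15–3.16.

THE OBJECTS (all the tree's).  `Y Z : SchemeOver ℂ`, `hY : IsSmoothProjective m Y`, `hZ : IsSmoothProjective n Z`, `Y ⊗ Z = Y ×_ℂ Z` with projections `fst`, `snd`; `Hᵏ(X) = BettiUniverse.hodge hHD hX k`;
`BettiUniverse.kunnethSummand hHD hY hZ k ⟨(i, j), _⟩` (`Hⁱ(Y) ⊗ Hʲ(Z)` as a `ℚ`-Hodge structure of weight `k`), `BettiUniverse.crossMap Y Z h` (`y ⊗ z ↦ pr₁^* y ∪ pr₂^* z`), `BettiUniverse.pull f k = f^*`, `bettiCup`;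
`lefschetzPowTo κ t k m h : Hᵏ → Hᵐ` (`Lᵗ_κ`, `k + 2t = m`); `ofRatClass` (`Hᵏ(−;ℚ) → Hᵏ(−;ℂ)`), `algebraicClasses X p = Nᵖ H²ᵖ(X(ℂ); ℂ)`, `HodgeConjectureFor`; `KaehlerRationalDatum n Z`.

WHAT IS PROVED (no hypothesis beyond smooth projectivity and the lane's binder `hHD`).
* §1 CUP IDENTITIES (all degrees): `crossMap (a ⊗ (κ ∪ c)) = pr₂^* κ ∪ crossMap (a ⊗ c)` for `κ ∈ H²(Z;ℚ)` (`BettiUniverse.crossMap_tmul_bettiCup_two_right`), **`crossMap ∘ (id ⊗ Lᵗ_κ) = Lᵗ_{pr₂^* κ} ∘ crossMap`**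
  (`BettiUniverse.crossMap_map_id_lefschetzPowTo`) and the mirror `crossMap ∘ (Lᵗ_κ ⊗ id) = Lᵗ_{pr₁^* κ} ∘ crossMap` (`BettiUniverse.crossMap_map_lefschetzPowTo_id`).
* §2 **`Lᵗ_κ` of a rational class `κ` whose complexification is a divisor class maps classes with algebraic complexification to classes with algebraic complexification**
  (`BettiUniverse.ofRatClass_lefschetzPowTo_mem_algebraicClasses_of_divisorClass`; the tree's `lefschetzOperator_mem_algebraicClasses_of_mem`, iterated over `ℚ`).
* §3 THE REDUCTION STEPS: **if the Hodge classes of the piece `Hⁱ(Y) ⊗ H^{j₀}(Z)` (`j₀ + s = n`) map to algebraic classes, so do those of `Hⁱ(Y) ⊗ H^{j₀+2s}(Z)`**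
  (`BettiUniverse.ofRatClass_crossMap_mem_algebraicClasses_of_hardLefschetz_right`), and the mirror in the first factor (`…_left`); every Hodge class of `Hⁱ(Y) ⊗ H^{j₀+2s}(Z)` is `(id ⊗ Lˢ_η) u` for a Hodge
  class `u` of `Hⁱ(Y) ⊗ H^{j₀}(Z)` (`BettiUniverse.exists_eq_map_id_lefschetzPowTo_of_mem_hodgeClasses`).
* §4 THE ASSEMBLY: **`HC(Y ⊗ Z)` as soon as, for every `c` and every `(i, j)` with `i + j = 2c`, `i ≤ m`, `j ≤ n`, the Hodge classes of `Hⁱ(Y) ⊗ Hʲ(Z)` map to algebraic classes**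
  (`BettiUniverse.hodgeConjectureFor_tensor_of_kunneth_pieces_le`); the pieces of total degree `2c ≤ 2` are free (`BettiUniverse.ofRatClass_crossMap_mem_algebraicClasses_of_le_one`), the pieces
  `H⁰(Y) ⊗ H^{2c}(Z)`, `H^{2c}(Y) ⊗ H⁰(Z)` are governed by `HC(Z)`, `HC(Y)` (`…_of_fst_zero`, `…_of_snd_zero`), whence the refined form **`HC(Y ⊗ Z)` ⟸ `HC(Y)`, `HC(Z)` and the pieces with
  `1 ≤ i ≤ m`, `1 ≤ j ≤ n`, `i + j = 2c ≥ 4`** (`BettiUniverse.hodgeConjectureFor_tensor_of_kunneth_pieces_pos_le`).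
* §5 **The Hodge classes of `H¹(Y) ⊗ H^{2n−1}(Z)` and of `H^{2m−1}(Y) ⊗ H¹(Z)` (`⊂ H^{2n}`, `⊂ H^{2m}`) are algebraic for ALL smooth projective `Y`, `Z`**
  (`BettiUniverse.ofRatClass_crossMap_mem_algebraicClasses_one_tensor_top_sub_one`, `…_top_sub_one_tensor_one`).

DEVIATIONS / SCOPE.  The genuinely open pieces are those with `2 ≤ i ≤ m`, `2 ≤ j ≤ n` or `{i, j} ∋ 1` with `i + j ≥ 4` below the middle (morphisms between transcendental parts, abelian sub-Hodge
structures of `H³`, …); nothing is claimed about them.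

## References
* [VoisinHodgeI2002] C. Voisin, *Hodge Theory and Complex Algebraic Geometry I* (2002) — §6.2.3 Thm. 6.25, Cor. 6.26, Rem. 6.27; §7.3.1 Def. 7.22, Lemma 7.23; §11.3.3 Thm. 11.38, Def. 11.39, Thm. 11.40,
  Lemma 11.41, p. 287; §11.3.1 Thm. 11.30; §11.3.2.
* [VoisinHodgeII2003] C. Voisin, *Hodge Theory and Complex Algebraic Geometry II* (2003) — §9.2.4 Prop. 9.20.
* [Voisin2013GHCBloch] C. Voisin, *The generalized Hodge and Bloch conjectures are equivalent for general complete intersections*, Ann. Sci. ÉNS 46 (2013) — Lemma 2.1 (proof).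
* [DeligneHodgeII1971] P. Deligne, *Théorie de Hodge II* (1971) — 1.1.12; 2.1.13–2.1.14.
* [Deligne2000] P. Deligne, *The Hodge conjecture* (Clay, 2000) — §1.
* [HatcherAT2002] A. Hatcher, *Algebraic Topology* (2002) — §3.2 Prop. 3.10, Thm. 3.11, Thm. 3.15–3.16.

## Provenance
Lane `lit-hodgefound` (Hodge path, Track 2), prover seat `lit-hodgefound-p29` (generation 29), self-proposed row g29-#2 (gen-28 HANDOFF free pointer (b): the general odd pieces via `L^{n−1}`, and
the general reduction it is a case of).
-/

noncomputable section

open scoped TensorProduct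
open CategoryTheory MonoidalCategory CartesianMonoidalCategory Module Finset
open Literature.AlgebraicTopology.SingularHomology
open Literature.Geometry.Kaehler

namespace Literature.AlgebraicGeometry.HodgeTheory

open Literature.AlgebraicGeometry.Motives
open Literature.AlgebraicGeometry.Motives.HodgeStructure

variable {m n d : ℕ} {X Y Z : SchemeOver ℂ}

/-! ### §1 The cup identities `crossMap ∘ (id ⊗ Lᵗ_κ) = Lᵗ_{pr₂^* κ} ∘ crossMap`, `crossMap ∘ (Lᵗ_κ ⊗ id) = Lᵗ_{pr₁^* κ} ∘ crossMap` -/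

/-- **`pr₁^* a ∪ pr₂^*(κ ∪ c) = pr₂^* κ ∪ (pr₁^* a ∪ pr₂^* c)`** for `a ∈ Hⁱ(Y;ℚ)`, `c ∈ Hʲ(Z;ℚ)`, `κ ∈ H²(Z;ℚ)` (naturality, associativity and graded commutativity of `∪`; the sign is `(−1)^{2i} = 1`).
[cite: HatcherAT2002, §3.2 Prop. 3.10 and Thm. 3.11] [cite: VoisinHodgeI2002, §11.3.3 Thm. 11.38] -/
theorem BettiUniverse.crossMap_tmul_bettiCup_two_right (κ : bettiCohomology Z 2) {i j j' k k' : ℕ} (hj : 2 + j = j') (hk : i + j = k) (hk' : i + j' = k') (h2 : 2 + k = k')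
    (a : bettiCohomology Y i) (c : bettiCohomology Z j) :
    BettiUniverse.crossMap Y Z hk' (a ⊗ₜ[ℚ] bettiCup hj κ c) = bettiCup h2 (BettiUniverse.pull (snd Y Z) 2 κ) (BettiUniverse.crossMap Y Z hk (a ⊗ₜ[ℚ] c)) := by
  rw [BettiUniverse.crossMap_tmul, BettiUniverse.crossMap_tmul,
    show BettiUniverse.pull (snd Y Z) j' (bettiCup hj κ c) = bettiCup hj (BettiUniverse.pull (snd Y Z) 2 κ) (BettiUniverse.pull (snd Y Z) j c) from bettiCup_map (snd Y Z) hj κ c,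
    ← bettiCup_assoc (rfl : i + 2 = i + 2) hj (show i + 2 + j = k' by omega) hk',
    bettiCup_gradedComm (cupProduct_gradedComm_holds _ _) (rfl : i + 2 = i + 2) (show 2 + i = i + 2 by omega) (BettiUniverse.pull (fst Y Z) i a) (BettiUniverse.pull (snd Y Z) 2 κ),
    show ((-1 : ℚ) ^ (i * 2)) = 1 from (even_two.mul_left i).neg_one_pow, one_smul,
    bettiCup_assoc (show 2 + i = i + 2 by omega) hk (show i + 2 + j = k' by omega) h2]

/-- **`pr₁^*(κ ∪ a) ∪ pr₂^* c = pr₁^* κ ∪ (pr₁^* a ∪ pr₂^* c)`** for `a ∈ Hⁱ(Y;ℚ)`, `c ∈ Hʲ(Z;ℚ)`, `κ ∈ H²(Y;ℚ)` (naturality and associativity of `∪`). [cite: HatcherAT2002, §3.2 Prop. 3.10] [cite: VoisinHodgeI2002, §11.3.3 Thm. 11.38] -/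
theorem BettiUniverse.crossMap_tmul_bettiCup_two_left (κ : bettiCohomology Y 2) {i i' j k k' : ℕ} (hi : 2 + i = i') (hk : i + j = k) (hk' : i' + j = k') (h2 : 2 + k = k')
    (a : bettiCohomology Y i) (c : bettiCohomology Z j) :
    BettiUniverse.crossMap Y Z hk' (bettiCup hi κ a ⊗ₜ[ℚ] c) = bettiCup h2 (BettiUniverse.pull (fst Y Z) 2 κ) (BettiUniverse.crossMap Y Z hk (a ⊗ₜ[ℚ] c)) := by
  rw [BettiUniverse.crossMap_tmul, BettiUniverse.crossMap_tmul,
    show BettiUniverse.pull (fst Y Z) i' (bettiCup hi κ a) = bettiCup hi (BettiUniverse.pull (fst Y Z) 2 κ) (BettiUniverse.pull (fst Y Z) i a) from bettiCup_map (fst Y Z) hi κ a,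
    bettiCup_assoc hi hk hk' h2]

/-- **`crossMap ∘ (id ⊗ Lᵗ_κ) = Lᵗ_{pr₂^* κ} ∘ crossMap` on pure tensors**: `pr₁^* a ∪ pr₂^*(Lᵗ_κ b) = Lᵗ_{pr₂^* κ}(pr₁^* a ∪ pr₂^* b)` (induction on `t`). [cite: HatcherAT2002, §3.2 Prop. 3.10 and Thm. 3.11] [cite: VoisinHodgeI2002, §6.2.3 (6.7) and §11.3.3 Thm. 11.38] -/
theorem BettiUniverse.crossMap_tmul_lefschetzPowTo_right (κ : bettiCohomology Z 2) :
    ∀ (t : ℕ) {i j j' k k' : ℕ} (hj : j + 2 * t = j') (hk : i + j = k) (hk' : i + j' = k') (hkk : k + 2 * t = k') (a : bettiCohomology Y i) (b : bettiCohomology Z j),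
      BettiUniverse.crossMap Y Z hk' (a ⊗ₜ[ℚ] lefschetzPowTo κ t j j' hj b) = lefschetzPowTo (BettiUniverse.pull (snd Y Z) 2 κ) t k k' hkk (BettiUniverse.crossMap Y Z hk (a ⊗ₜ[ℚ] b))
  | 0, i, j, j', k, k', hj, hk, hk', hkk, a, b => by
    obtain rfl : j = j' := by omega
    obtain rfl : k = k' := by omega
    have h₁ : lefschetzPowTo κ 0 j j hj b = b := lefschetzPowTo_zero_apply κ j b
    have h₂ : lefschetzPowTo (BettiUniverse.pull (snd Y Z) 2 κ) 0 k k hkk (BettiUniverse.crossMap Y Z hk (a ⊗ₜ[ℚ] b)) = BettiUniverse.crossMap Y Z hk (a ⊗ₜ[ℚ] b) :=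
      lefschetzPowTo_zero_apply _ k _
    rw [h₁, h₂]
  | t + 1, i, j, j', k, k', hj, hk, hk', hkk, a, b => by
    rw [lefschetzPowTo_succ_apply κ t j (j + 2 * t) j' rfl hj (by omega), lefschetzPowTo_succ_apply (BettiUniverse.pull (snd Y Z) 2 κ) t k (k + 2 * t) k' rfl hkk (by omega),
      ← BettiUniverse.crossMap_tmul_lefschetzPowTo_right κ t rfl hk (show i + (j + 2 * t) = k + 2 * t by omega) rfl a b, lefschetzOperator_apply, lefschetzOperator_apply]
    exact BettiUniverse.crossMap_tmul_bettiCup_two_right κ (by omega) (show i + (j + 2 * t) = k + 2 * t by omega) hk' (by omega) a _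

/-- **`crossMap ∘ (id ⊗ Lᵗ_κ) = Lᵗ_{pr₂^* κ} ∘ crossMap`** on `Hⁱ(Y;ℚ) ⊗ Hʲ(Z;ℚ)`, `κ ∈ H²(Z;ℚ)`, all degrees. [cite: HatcherAT2002, §3.2 Prop. 3.10 and Thm. 3.11] [cite: VoisinHodgeI2002, §6.2.3 (6.7) and §11.3.3 Thm. 11.38] -/
theorem BettiUniverse.crossMap_map_id_lefschetzPowTo (κ : bettiCohomology Z 2) (t : ℕ) {i j j' k k' : ℕ} (hj : j + 2 * t = j') (hk : i + j = k) (hk' : i + j' = k') (hkk : k + 2 * t = k')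
    (u : bettiCohomology Y i ⊗[ℚ] bettiCohomology Z j) :
    BettiUniverse.crossMap Y Z hk' (TensorProduct.map LinearMap.id (lefschetzPowTo κ t j j' hj) u) = lefschetzPowTo (BettiUniverse.pull (snd Y Z) 2 κ) t k k' hkk (BettiUniverse.crossMap Y Z hk u) := by
  induction u using TensorProduct.induction_on with
  | zero => rw [map_zero, map_zero, map_zero, map_zero]
  | tmul a b => rw [TensorProduct.map_tmul, LinearMap.id_apply, BettiUniverse.crossMap_tmul_lefschetzPowTo_right κ t hj hk hk' hkk a b]
  | add x y hx hy => rw [map_add, map_add, hx, hy, map_add, map_add]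

/-- **`crossMap ∘ (Lᵗ_κ ⊗ id) = Lᵗ_{pr₁^* κ} ∘ crossMap` on pure tensors** (`κ ∈ H²(Y;ℚ)`). [cite: HatcherAT2002, §3.2 Prop. 3.10] [cite: VoisinHodgeI2002, §6.2.3 (6.7) and §11.3.3 Thm. 11.38] -/
theorem BettiUniverse.crossMap_tmul_lefschetzPowTo_left (κ : bettiCohomology Y 2) :
    ∀ (t : ℕ) {i i' j k k' : ℕ} (hi : i + 2 * t = i') (hk : i + j = k) (hk' : i' + j = k') (hkk : k + 2 * t = k') (a : bettiCohomology Y i) (b : bettiCohomology Z j),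
      BettiUniverse.crossMap Y Z hk' (lefschetzPowTo κ t i i' hi a ⊗ₜ[ℚ] b) = lefschetzPowTo (BettiUniverse.pull (fst Y Z) 2 κ) t k k' hkk (BettiUniverse.crossMap Y Z hk (a ⊗ₜ[ℚ] b))
  | 0, i, i', j, k, k', hi, hk, hk', hkk, a, b => by
    obtain rfl : i = i' := by omega
    obtain rfl : k = k' := by omega
    have h₁ : lefschetzPowTo κ 0 i i hi a = a := lefschetzPowTo_zero_apply κ i a
    have h₂ : lefschetzPowTo (BettiUniverse.pull (fst Y Z) 2 κ) 0 k k hkk (BettiUniverse.crossMap Y Z hk (a ⊗ₜ[ℚ] b)) = BettiUniverse.crossMap Y Z hk (a ⊗ₜ[ℚ] b) :=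
      lefschetzPowTo_zero_apply _ k _
    rw [h₁, h₂]
  | t + 1, i, i', j, k, k', hi, hk, hk', hkk, a, b => by
    rw [lefschetzPowTo_succ_apply κ t i (i + 2 * t) i' rfl hi (by omega), lefschetzPowTo_succ_apply (BettiUniverse.pull (fst Y Z) 2 κ) t k (k + 2 * t) k' rfl hkk (by omega),
      ← BettiUniverse.crossMap_tmul_lefschetzPowTo_left κ t rfl hk (show i + 2 * t + j = k + 2 * t by omega) rfl a b, lefschetzOperator_apply, lefschetzOperator_apply]
    exact BettiUniverse.crossMap_tmul_bettiCup_two_left κ (by omega) (show i + 2 * t + j = k + 2 * t by omega) hk' (by omega) _ b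

/-- **`crossMap ∘ (Lᵗ_κ ⊗ id) = Lᵗ_{pr₁^* κ} ∘ crossMap`** on `Hⁱ(Y;ℚ) ⊗ Hʲ(Z;ℚ)`, `κ ∈ H²(Y;ℚ)`, all degrees. [cite: HatcherAT2002, §3.2 Prop. 3.10] [cite: VoisinHodgeI2002, §6.2.3 (6.7) and §11.3.3 Thm. 11.38] -/
theorem BettiUniverse.crossMap_map_lefschetzPowTo_id (κ : bettiCohomology Y 2) (t : ℕ) {i i' j k k' : ℕ} (hi : i + 2 * t = i') (hk : i + j = k) (hk' : i' + j = k') (hkk : k + 2 * t = k')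
    (u : bettiCohomology Y i ⊗[ℚ] bettiCohomology Z j) :
    BettiUniverse.crossMap Y Z hk' (TensorProduct.map (lefschetzPowTo κ t i i' hi) LinearMap.id u) = lefschetzPowTo (BettiUniverse.pull (fst Y Z) 2 κ) t k k' hkk (BettiUniverse.crossMap Y Z hk u) := by
  induction u using TensorProduct.induction_on with
  | zero => rw [map_zero, map_zero, map_zero, map_zero]
  | tmul a b => rw [TensorProduct.map_tmul, LinearMap.id_apply, BettiUniverse.crossMap_tmul_lefschetzPowTo_left κ t hi hk hk' hkk a b]
  | add x y hx hy => rw [map_add, map_add, hx, hy, map_add, map_add]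

/-! ### §2 `Lᵗ` of a divisor class preserves classes with algebraic complexification -/

/-- `(Lᵗ_κ u) ⊗ 1 = Lᵗ_{κ ⊗ 1}(u ⊗ 1)` for any `κ ∈ H²(X(ℂ); ℚ)` (change of coefficients is multiplicative; the tree's `ringChange_lefschetzPowTo` for `ℚ ⊆ ℂ` — private copy of the
`KaehlerRationalDatum`/summit-side spelling for an arbitrary rational `κ`). [cite: HatcherAT2002, §3.2 p. 215] [cite: VoisinHodgeI2002, §7.1.2] -/
private theorem ofRatClass_lefschetzPowTo_rat (κ : bettiCohomology X 2) (t a b : ℕ) (h : a + 2 * t = b) (u : bettiCohomology X a) :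
    ofRatClass (ComplexPoints X) b (lefschetzPowTo κ t a b h u) = lefschetzPowTo (ofRatClass (ComplexPoints X) 2 κ) t a b h (ofRatClass (ComplexPoints X) a u) := by
  rw [ofRatClass_eq_ringChange, ofRatClass_eq_ringChange, ofRatClass_eq_ringChange]
  exact ringChange_lefschetzPowTo κ (algebraMap ℚ ℂ) t a b h u

/-- **`(Lᵗ_κ u) ⊗ 1 ∈ N^q` for `u ⊗ 1 ∈ Nʲ` and `κ ⊗ 1 ∈ N¹`** (`2j + 2t = 2q`) on a smooth projective complex `X`: `(Lᵗ_κ u) ⊗ 1 = Lᵗ_{κ ⊗ 1}(u ⊗ 1)` (change of coefficients is multiplicative) and the Lefschetz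
operator of ANY divisor class maps `Nˡ H²ˡ` into `Nˡ⁺¹ H²ˡ⁺²` («`cl(Z · D) = cl(Z) ∪ cl(D)`», the tree's `lefschetzOperator_mem_algebraicClasses_of_mem`, proved with no moving lemma); induction on `t`.
[cite: VoisinHodgeII2003, §9.2.4 Prop. 9.20] [cite: Voisin2013GHCBloch, Lemma 2.1 (proof)] [cite: HatcherAT2002, §3.2 p. 215] -/
theorem BettiUniverse.ofRatClass_lefschetzPowTo_mem_algebraicClasses_of_divisorClass (hX : IsSmoothProjective n X) {κ : bettiCohomology X 2}
    (hκ : ofRatClass (ComplexPoints X) 2 κ ∈ algebraicClasses X 1) :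
    ∀ (t : ℕ) {j q : ℕ} (h : 2 * j + 2 * t = 2 * q) {u : bettiCohomology X (2 * j)}, ofRatClass (ComplexPoints X) (2 * j) u ∈ algebraicClasses X j →
      ofRatClass (ComplexPoints X) (2 * q) (lefschetzPowTo κ t (2 * j) (2 * q) h u) ∈ algebraicClasses X q
  | 0, j, q, h, u, hu => by
    obtain rfl : j = q := by omega
    have h0 : lefschetzPowTo κ 0 (2 * j) (2 * j) h u = u := lefschetzPowTo_zero_apply κ (2 * j) u
    rw [h0]
    exact hu
  | t + 1, j, q, h, u, hu => by
    obtain ⟨q', rfl⟩ : ∃ q', q = q' + 1 := ⟨j + t, by omega⟩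
    have ih := BettiUniverse.ofRatClass_lefschetzPowTo_mem_algebraicClasses_of_divisorClass hX hκ t (by omega : 2 * j + 2 * t = 2 * q') hu
    rw [ofRatClass_lefschetzPowTo_rat] at ih
    rw [ofRatClass_lefschetzPowTo_rat, lefschetzPowTo_succ_apply (ofRatClass (ComplexPoints X) 2 κ) t (2 * j) (2 * q') (2 * (q' + 1)) (by omega) h (by omega)]
    exact lefschetzOperator_mem_algebraicClasses_of_mem hX hκ q' ih

/-- The same with free degree spellings `a = 2j`, `a + 2t = b = 2q` (so that it rewrites `lefschetzPowTo κ t a b h` terms verbatim). [cite: VoisinHodgeII2003, §9.2.4 Prop. 9.20] -/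
theorem BettiUniverse.ofRatClass_lefschetzPowTo_mem_algebraicClasses_of_divisorClass' (hX : IsSmoothProjective n X) {κ : bettiCohomology X 2}
    (hκ : ofRatClass (ComplexPoints X) 2 κ ∈ algebraicClasses X 1) (t : ℕ) {a b j q : ℕ} (ha : a = 2 * j) (hb : b = 2 * q) (h : a + 2 * t = b) {u : bettiCohomology X a}
    (hu : ofRatClass (ComplexPoints X) a u ∈ supportedClasses X a j) : ofRatClass (ComplexPoints X) b (lefschetzPowTo κ t a b h u) ∈ supportedClasses X b q := by
  subst ha
  subst hb
  exact BettiUniverse.ofRatClass_lefschetzPowTo_mem_algebraicClasses_of_divisorClass hX hκ t h hu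

/-- **A rational Kähler class pulls back to a divisor class of the product**: `(pr₂^* η) ⊗ 1 ∈ N¹H²(Y × Z)` (`η ⊗ 1` is of type `(1,1)`, pull-backs are morphisms of Hodge structures, Lefschetz `(1,1)`).
[cite: VoisinHodgeI2002, §7.3.2 and §11.3.1 Thm. 11.30] -/
theorem KaehlerRationalDatum.ofRatClass_pull_snd_eta_mem_algebraicClasses (D : KaehlerRationalDatum n Z) (hHD : exists_isReal_hodgeModel) (hZ : IsSmoothProjective n Z)
    (hYZ : IsSmoothProjective d (Y ⊗ Z)) : ofRatClass (ComplexPoints (Y ⊗ Z)) 2 (BettiUniverse.pull (snd Y Z) 2 D.η) ∈ algebraicClasses (Y ⊗ Z) 1 := by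
  have hη : D.η ∈ (BettiUniverse.hodge hHD hZ (2 * 1)).hodgeClasses ((1 : ℕ) : ℤ) := (BettiUniverse.mem_hodgeClasses_hodge_iff_isOfHodgeType hHD hZ 1 D.η).2 D.isOfHodgeType_Hη
  have hη' := (BettiUniverse.pullHodgeHom hHD hodgePQ_independent_of_hodgeModel_holds hYZ hZ (snd Y Z) (2 * 1)).map_hodgeClasses_le ((1 : ℕ) : ℤ) ⟨D.η, hη, rfl⟩
  rw [BettiUniverse.pullHodgeHom_toLinearMap] at hη'
  exact (BettiUniverse.mem_hodgeClasses_hodge_iff_ofRatClass_mem_algebraicClasses hHD hYZ (p := 1) (Or.inl le_rfl) _).1 hη'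

/-- The mirror: `(pr₁^* η) ⊗ 1 ∈ N¹H²(Y × Z)` for a rational Kähler class `η` of `Y`. [cite: VoisinHodgeI2002, §7.3.2 and §11.3.1 Thm. 11.30] -/
theorem KaehlerRationalDatum.ofRatClass_pull_fst_eta_mem_algebraicClasses (D : KaehlerRationalDatum m Y) (hHD : exists_isReal_hodgeModel) (hY : IsSmoothProjective m Y)
    (hYZ : IsSmoothProjective d (Y ⊗ Z)) : ofRatClass (ComplexPoints (Y ⊗ Z)) 2 (BettiUniverse.pull (fst Y Z) 2 D.η) ∈ algebraicClasses (Y ⊗ Z) 1 := by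
  have hη : D.η ∈ (BettiUniverse.hodge hHD hY (2 * 1)).hodgeClasses ((1 : ℕ) : ℤ) := (BettiUniverse.mem_hodgeClasses_hodge_iff_isOfHodgeType hHD hY 1 D.η).2 D.isOfHodgeType_Hη
  have hη' := (BettiUniverse.pullHodgeHom hHD hodgePQ_independent_of_hodgeModel_holds hYZ hY (fst Y Z) (2 * 1)).map_hodgeClasses_le ((1 : ℕ) : ℤ) ⟨D.η, hη, rfl⟩
  rw [BettiUniverse.pullHodgeHom_toLinearMap] at hη'
  exact (BettiUniverse.mem_hodgeClasses_hodge_iff_ofRatClass_mem_algebraicClasses hHD hYZ (p := 1) (Or.inl le_rfl) _).1 hη'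

/-- A piece `Hⁱ(Y) ⊗ Hʲ(Z)` with `i > 2 dim Y` or `j > 2 dim Z` is zero, so its (unique) class maps to an algebraic class. [cite: HatcherAT2002, §3.3 Thm. 3.26] -/
theorem BettiUniverse.ofRatClass_crossMap_mem_algebraicClasses_of_lt (hY : IsSmoothProjective m Y) (hZ : IsSmoothProjective n Z) {i j c : ℕ} (hc : i + j = 2 * c) (h : 2 * m < i ∨ 2 * n < j)
    (t : bettiCohomology Y i ⊗[ℚ] bettiCohomology Z j) : ofRatClass (ComplexPoints (Y ⊗ Z)) (2 * c) (BettiUniverse.crossMap Y Z hc t) ∈ algebraicClasses (Y ⊗ Z) c := by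
  haveI := BettiUniverse.finite hY i
  haveI := BettiUniverse.finite hZ j
  haveI : Subsingleton (bettiCohomology Y i ⊗[ℚ] bettiCohomology Z j) := by
    rcases h with h | h
    · haveI : Subsingleton (bettiCohomology Y i) := Module.finrank_zero_iff.1 (BettiUniverse.finrank_bettiCohomology_eq_zero_of_lt hY h)
      infer_instance
    · haveI : Subsingleton (bettiCohomology Z j) := Module.finrank_zero_iff.1 (BettiUniverse.finrank_bettiCohomology_eq_zero_of_lt hZ h)
      infer_instance
  rw [Subsingleton.elim t 0, map_zero, map_zero]
  exact Submodule.zero_mem _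

/-! ### §3 The reduction steps: a piece `Hⁱ(Y) ⊗ Hʲ(Z)` with `j > dim Z` (resp. `i > dim Y`) reduces to `Hⁱ(Y) ⊗ H^{2 dim Z − j}(Z)` (resp. `H^{2 dim Y − i}(Y) ⊗ Hʲ(Z)`) -/

section Reduction

variable [HodgeTensorFacts.{0, 0}]

/-- **Every Hodge class of the piece `Hⁱ(Y) ⊗ H^{j₀+2s}(Z)` (`j₀ + s = dim Z`, total degree `2c`) is `(id ⊗ Lˢ_η) u` for a Hodge class `u` of `Hⁱ(Y) ⊗ H^{j₀}(Z)` (total degree `2(c − s)`)**, for every Kähler–rational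
datum of `Z`: `id ⊗ Lˢ_η : Hⁱ(Y) ⊗ H^{j₀}(Z) ⥲ (Hⁱ(Y) ⊗ Hʲ(Z))(s)` is a bijective morphism of `ℚ`-Hodge structures (hard Lefschetz, Thm. 6.25 + Rem. 6.27, tensored with the identity, Deligne 1.1.12), hence maps
Hodge classes ONTO Hodge classes (Lemma 7.23), and `Hdg^{c−s}((H ⊗ H')(s)… ) = Hdg^c` under the twist. [cite: VoisinHodgeI2002, §6.2.3 Thm. 6.25, Rem. 6.27, §7.3.1 Lemma 7.23 and §11.3.3 Thm. 11.40]
[cite: DeligneHodgeII1971, 1.1.12 and 2.1.13–2.1.14] -/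
theorem BettiUniverse.exists_eq_map_id_lefschetzPowTo_of_mem_hodgeClasses (hHD : exists_isReal_hodgeModel) (hY : IsSmoothProjective m Y) (hZ : IsSmoothProjective n Z) (D : KaehlerRationalDatum n Z)
    {i j₀ j s c₀ c : ℕ} (hjs : j₀ + s = n) (hj : j₀ + 2 * s = j) (hc₀ : i + j₀ = 2 * c₀) (hc : i + j = 2 * c) {t : bettiCohomology Y i ⊗[ℚ] bettiCohomology Z j}
    (ht : t ∈ (BettiUniverse.kunnethSummand hHD hY hZ (2 * c) ⟨(i, j), HasAntidiagonal.mem_antidiagonal.2 hc⟩).hodgeClasses c) :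
    ∃ u ∈ (BettiUniverse.kunnethSummand hHD hY hZ (2 * c₀) ⟨(i, j₀), HasAntidiagonal.mem_antidiagonal.2 hc₀⟩).hodgeClasses c₀, t = TensorProduct.map LinearMap.id (lefschetzPowTo D.η s j₀ j hj) u := by
  haveI := BettiUniverse.finite hY i
  haveI := BettiUniverse.finite hZ j₀
  haveI := BettiUniverse.finite hZ j
  obtain ⟨f, hf, hfb⟩ := D.exists_hom_hodge_bijective_toLinearMap_eq_lefschetzPowTo hHD hZ (t := s) (k := j₀) (m := j) hjs hj (by omega)
  set Φ := HodgeStructure.Hom.tensorMap (HodgeStructure.Hom.id (BettiUniverse.hodge hHD hY i)) f with hΦ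
  have hΦmap : Φ.toLinearMap = TensorProduct.map LinearMap.id (lefschetzPowTo D.η s j₀ j hj) := by
    rw [hΦ, HodgeStructure.Hom.tensorMap_toLinearMap, HodgeStructure.Hom.id_toLinearMap, hf]
  have hΦb : Function.Bijective Φ.toLinearMap := by
    set E := TensorProduct.congr (LinearEquiv.refl ℚ (bettiCohomology Y i)) (LinearEquiv.ofBijective f.toLinearMap hfb) with hE
    have hco : ⇑Φ.toLinearMap = ⇑E := by
      funext u
      induction u using TensorProduct.induction_on with
      | zero => rw [map_zero, map_zero]
      | tmul a b => rw [hΦ, HodgeStructure.Hom.tensorMap_toLinearMap, HodgeStructure.Hom.id_toLinearMap, TensorProduct.map_tmul, hE, TensorProduct.congr_tmul, LinearEquiv.refl_apply,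
          LinearEquiv.ofBijective_apply, LinearMap.id_apply]
      | add x y hx hy => rw [map_add, map_add, hx, hy]
    rw [hco]
    exact E.bijective
  have ht' : t ∈ (((BettiUniverse.hodge hHD hY i).tensor (BettiUniverse.hodge hHD hZ j₀)).hodgeClasses c₀).map Φ.toLinearMap := by
    rw [Φ.map_hodgeClasses_eq_of_bijective hΦb c₀, HodgeStructure.mem_hodgeClasses_iff, HodgeStructure.tensor_F]
    have e := HodgeStructure.tensorFiltration_tateTwist_right (BettiUniverse.hodge hHD hY i) (BettiUniverse.hodge hHD hZ j) (s : ℤ) (c₀ : ℤ)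
    rw [show (c₀ : ℤ) + (s : ℤ) = (c : ℤ) by omega] at e
    change HodgeStructure.ofRat t ∈ (BettiUniverse.hodge hHD hY i).tensorFiltration ((BettiUniverse.hodge hHD hZ j).tateTwist (s : ℤ)) c₀
    rw [e]
    exact (HodgeStructure.mem_hodgeClasses_iff _ _ _).1 ht
  obtain ⟨u, hu, rfl⟩ := ht'
  refine ⟨u, ?_, by rw [hΦmap]⟩
  change u ∈ (((BettiUniverse.hodge hHD hY i).tensor (BettiUniverse.hodge hHD hZ j₀)).cast _).hodgeClasses _
  rw [HodgeStructure.cast_hodgeClasses]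
  exact hu

/-- The mirror: **every Hodge class of `H^{i₀+2s}(Y) ⊗ Hʲ(Z)` (`i₀ + s = dim Y`) is `(Lˢ_η ⊗ id) u` for a Hodge class `u` of `H^{i₀}(Y) ⊗ Hʲ(Z)`**, for every Kähler–rational datum of `Y`.
[cite: VoisinHodgeI2002, §6.2.3 Thm. 6.25, Rem. 6.27, §7.3.1 Lemma 7.23 and §11.3.3 Thm. 11.40] [cite: DeligneHodgeII1971, 1.1.12 and 2.1.13–2.1.14] -/
theorem BettiUniverse.exists_eq_map_lefschetzPowTo_id_of_mem_hodgeClasses (hHD : exists_isReal_hodgeModel) (hY : IsSmoothProjective m Y) (hZ : IsSmoothProjective n Z) (D : KaehlerRationalDatum m Y)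
    {i₀ i j s c₀ c : ℕ} (his : i₀ + s = m) (hi : i₀ + 2 * s = i) (hc₀ : i₀ + j = 2 * c₀) (hc : i + j = 2 * c) {t : bettiCohomology Y i ⊗[ℚ] bettiCohomology Z j}
    (ht : t ∈ (BettiUniverse.kunnethSummand hHD hY hZ (2 * c) ⟨(i, j), HasAntidiagonal.mem_antidiagonal.2 hc⟩).hodgeClasses c) :
    ∃ u ∈ (BettiUniverse.kunnethSummand hHD hY hZ (2 * c₀) ⟨(i₀, j), HasAntidiagonal.mem_antidiagonal.2 hc₀⟩).hodgeClasses c₀, t = TensorProduct.map (lefschetzPowTo D.η s i₀ i hi) LinearMap.id u := by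
  haveI := BettiUniverse.finite hZ j
  haveI := BettiUniverse.finite hY i₀
  haveI := BettiUniverse.finite hY i
  obtain ⟨f, hf, hfb⟩ := D.exists_hom_hodge_bijective_toLinearMap_eq_lefschetzPowTo hHD hY (t := s) (k := i₀) (m := i) his hi (by omega)
  set Φ := HodgeStructure.Hom.tensorMap f (HodgeStructure.Hom.id (BettiUniverse.hodge hHD hZ j)) with hΦ
  have hΦmap : Φ.toLinearMap = TensorProduct.map (lefschetzPowTo D.η s i₀ i hi) LinearMap.id := by
    rw [hΦ, HodgeStructure.Hom.tensorMap_toLinearMap, HodgeStructure.Hom.id_toLinearMap, hf]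
  have hΦb : Function.Bijective Φ.toLinearMap := by
    set E := TensorProduct.congr (LinearEquiv.ofBijective f.toLinearMap hfb) (LinearEquiv.refl ℚ (bettiCohomology Z j)) with hE
    have hco : ⇑Φ.toLinearMap = ⇑E := by
      funext u
      induction u using TensorProduct.induction_on with
      | zero => rw [map_zero, map_zero]
      | tmul a b => rw [hΦ, HodgeStructure.Hom.tensorMap_toLinearMap, HodgeStructure.Hom.id_toLinearMap, TensorProduct.map_tmul, hE, TensorProduct.congr_tmul, LinearEquiv.refl_apply,
          LinearEquiv.ofBijective_apply, LinearMap.id_apply]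
      | add x y hx hy => rw [map_add, map_add, hx, hy]
    rw [hco]
    exact E.bijective
  have ht' : t ∈ (((BettiUniverse.hodge hHD hY i₀).tensor (BettiUniverse.hodge hHD hZ j)).hodgeClasses c₀).map Φ.toLinearMap := by
    rw [Φ.map_hodgeClasses_eq_of_bijective hΦb c₀, HodgeStructure.mem_hodgeClasses_iff, HodgeStructure.tensor_F]
    have e := HodgeStructure.tensorFiltration_tateTwist_left (BettiUniverse.hodge hHD hY i) (BettiUniverse.hodge hHD hZ j) (s : ℤ) (c₀ : ℤ)
    rw [show (c₀ : ℤ) + (s : ℤ) = (c : ℤ) by omega] at e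
    change HodgeStructure.ofRat t ∈ ((BettiUniverse.hodge hHD hY i).tateTwist (s : ℤ)).tensorFiltration (BettiUniverse.hodge hHD hZ j) c₀
    rw [e]
    exact (HodgeStructure.mem_hodgeClasses_iff _ _ _).1 ht
  obtain ⟨u, hu, rfl⟩ := ht'
  refine ⟨u, ?_, by rw [hΦmap]⟩
  change u ∈ (((BettiUniverse.hodge hHD hY i₀).tensor (BettiUniverse.hodge hHD hZ j)).cast _).hodgeClasses _
  rw [HodgeStructure.cast_hodgeClasses]
  exact hu

/-- **THE REDUCTION STEP IN THE SECOND FACTOR.**  Let `j₀ + s = dim Z`, `j = j₀ + 2s`, `i + j₀ = 2c₀`, `i + j = 2c`.  If the Hodge classes of the piece `Hⁱ(Y) ⊗ H^{j₀}(Z)` of `H^{2c₀}(Y × Z)` map (under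
`crossMap`, complexified) to algebraic classes, then so do the Hodge classes of the piece `Hⁱ(Y) ⊗ Hʲ(Z)` of `H^{2c}(Y × Z)`: `t = (id ⊗ Lˢ_η) u`, `crossMap t = Lˢ_{pr₂^* η}(crossMap u)` and `Lˢ` of the
divisor class `pr₂^* η` maps `N^{c₀}` into `N^c` — unconditionally. [cite: VoisinHodgeI2002, §6.2.3 Thm. 6.25, Rem. 6.27, §7.3.1 Lemma 7.23, §11.3.3 Thm. 11.38–11.40 and p. 287, §11.3.1 Thm. 11.30]
[cite: VoisinHodgeII2003, §9.2.4 Prop. 9.20] [cite: Voisin2013GHCBloch, Lemma 2.1 (proof)] -/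
theorem BettiUniverse.ofRatClass_crossMap_mem_algebraicClasses_of_hardLefschetz_right (hHD : exists_isReal_hodgeModel) (hY : IsSmoothProjective m Y) (hZ : IsSmoothProjective n Z)
    (hYZ : IsSmoothProjective d (Y ⊗ Z)) {i j₀ j s c₀ c : ℕ} (hjs : j₀ + s = n) (hj : j₀ + 2 * s = j) (hc₀ : i + j₀ = 2 * c₀) (hc : i + j = 2 * c)
    (halg : ∀ u ∈ (BettiUniverse.kunnethSummand hHD hY hZ (2 * c₀) ⟨(i, j₀), HasAntidiagonal.mem_antidiagonal.2 hc₀⟩).hodgeClasses c₀,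
      ofRatClass (ComplexPoints (Y ⊗ Z)) (2 * c₀) (BettiUniverse.crossMap Y Z hc₀ u) ∈ algebraicClasses (Y ⊗ Z) c₀)
    {t : bettiCohomology Y i ⊗[ℚ] bettiCohomology Z j} (ht : t ∈ (BettiUniverse.kunnethSummand hHD hY hZ (2 * c) ⟨(i, j), HasAntidiagonal.mem_antidiagonal.2 hc⟩).hodgeClasses c) :
    ofRatClass (ComplexPoints (Y ⊗ Z)) (2 * c) (BettiUniverse.crossMap Y Z hc t) ∈ algebraicClasses (Y ⊗ Z) c := by
  obtain ⟨D⟩ := nonempty_kaehlerRationalDatum hZ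
  obtain ⟨u, hu, rfl⟩ := BettiUniverse.exists_eq_map_id_lefschetzPowTo_of_mem_hodgeClasses hHD hY hZ D hjs hj hc₀ hc ht
  rw [BettiUniverse.crossMap_map_id_lefschetzPowTo D.η s hj hc₀ hc (by omega)]
  exact BettiUniverse.ofRatClass_lefschetzPowTo_mem_algebraicClasses_of_divisorClass hYZ (D.ofRatClass_pull_snd_eta_mem_algebraicClasses hHD hZ hYZ) s (by omega) (halg u hu)

/-- **THE REDUCTION STEP IN THE FIRST FACTOR** (`i₀ + s = dim Y`, `i = i₀ + 2s`): if the Hodge classes of `H^{i₀}(Y) ⊗ Hʲ(Z)` map to algebraic classes, so do those of `Hⁱ(Y) ⊗ Hʲ(Z)`.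
[cite: VoisinHodgeI2002, §6.2.3 Thm. 6.25, Rem. 6.27, §7.3.1 Lemma 7.23, §11.3.3 Thm. 11.38–11.40 and p. 287, §11.3.1 Thm. 11.30] [cite: VoisinHodgeII2003, §9.2.4 Prop. 9.20] [cite: Voisin2013GHCBloch, Lemma 2.1 (proof)] -/
theorem BettiUniverse.ofRatClass_crossMap_mem_algebraicClasses_of_hardLefschetz_left (hHD : exists_isReal_hodgeModel) (hY : IsSmoothProjective m Y) (hZ : IsSmoothProjective n Z)
    (hYZ : IsSmoothProjective d (Y ⊗ Z)) {i₀ i j s c₀ c : ℕ} (his : i₀ + s = m) (hi : i₀ + 2 * s = i) (hc₀ : i₀ + j = 2 * c₀) (hc : i + j = 2 * c)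
    (halg : ∀ u ∈ (BettiUniverse.kunnethSummand hHD hY hZ (2 * c₀) ⟨(i₀, j), HasAntidiagonal.mem_antidiagonal.2 hc₀⟩).hodgeClasses c₀,
      ofRatClass (ComplexPoints (Y ⊗ Z)) (2 * c₀) (BettiUniverse.crossMap Y Z hc₀ u) ∈ algebraicClasses (Y ⊗ Z) c₀)
    {t : bettiCohomology Y i ⊗[ℚ] bettiCohomology Z j} (ht : t ∈ (BettiUniverse.kunnethSummand hHD hY hZ (2 * c) ⟨(i, j), HasAntidiagonal.mem_antidiagonal.2 hc⟩).hodgeClasses c) :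
    ofRatClass (ComplexPoints (Y ⊗ Z)) (2 * c) (BettiUniverse.crossMap Y Z hc t) ∈ algebraicClasses (Y ⊗ Z) c := by
  obtain ⟨D⟩ := nonempty_kaehlerRationalDatum hY
  obtain ⟨u, hu, rfl⟩ := BettiUniverse.exists_eq_map_lefschetzPowTo_id_of_mem_hodgeClasses hHD hY hZ D his hi hc₀ hc ht
  rw [BettiUniverse.crossMap_map_lefschetzPowTo_id D.η s hi hc₀ hc (by omega)]
  exact BettiUniverse.ofRatClass_lefschetzPowTo_mem_algebraicClasses_of_divisorClass hYZ (D.ofRatClass_pull_fst_eta_mem_algebraicClasses hHD hY hYZ) s (by omega) (halg u hu)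

/-! ### §4 The assembly: `HC(Y × Z)` from the pieces `Hⁱ(Y) ⊗ Hʲ(Z)` with `i ≤ dim Y`, `j ≤ dim Z` -/

/-- **The pieces of total degree `2c ≤ 2` and `2c ≥ 2 dim(Y × Z) − 2` are free**: the cross product of a Hodge class of `Hⁱ(Y) ⊗ Hʲ(Z)` is a Hodge class of `H^{2c}(Y × Z)` (Thm. 11.40), algebraic in the
Lefschetz range (`Hdg⁰ = ℚ·[Y × Z]`, Lefschetz `(1,1)`, and the dual degrees by hard Lefschetz). [cite: VoisinHodgeI2002, §11.3.3 Thm. 11.40, §11.3.1 Thm. 11.30 and §11.3.2] [cite: Deligne2000, §1] -/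
theorem BettiUniverse.ofRatClass_crossMap_mem_algebraicClasses_of_lefschetzRange (hHD : exists_isReal_hodgeModel) (hY : IsSmoothProjective m Y) (hZ : IsSmoothProjective n Z)
    (hYZ : IsSmoothProjective d (Y ⊗ Z)) {i j c : ℕ} (hc : i + j = 2 * c) (hcr : c ≤ 1 ∨ d ≤ c + 1) {t : bettiCohomology Y i ⊗[ℚ] bettiCohomology Z j}
    (ht : t ∈ (BettiUniverse.kunnethSummand hHD hY hZ (2 * c) ⟨(i, j), HasAntidiagonal.mem_antidiagonal.2 hc⟩).hodgeClasses c) :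
    ofRatClass (ComplexPoints (Y ⊗ Z)) (2 * c) (BettiUniverse.crossMap Y Z hc t) ∈ algebraicClasses (Y ⊗ Z) c :=
  (BettiUniverse.mem_hodgeClasses_hodge_iff_ofRatClass_mem_algebraicClasses hHD hYZ hcr _).1
    (BettiUniverse.crossMap_mem_hodgeClasses hHD hodgePQ_independent_of_hodgeModel_holds hY hZ hYZ hc c ht)

/-- **THE ASSEMBLY.  `HC(Y × Z)` holds as soon as, for every `c` and every `(i, j)` with `i + j = 2c`, `i ≤ dim Y` and `j ≤ dim Z`, the Hodge classes of the Künneth piece `Hⁱ(Y) ⊗ Hʲ(Z)` of `H^{2c}(Y × Z)`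
map to algebraic classes** — unconditionally.  Every rational `(c,c)`-class of `Y × Z` is `Σ_{i+j=2c} crossMap tᵢⱼ` with `tᵢⱼ` Hodge classes of the pieces (Thm. 11.38/11.40 + Lemma 7.23); a piece with
`i > dim Y` is reduced to `(2 dim Y − i, j)` and then, if `j > dim Z`, to `(2 dim Y − i, 2 dim Z − j)` (§3); pieces beyond the top degree vanish. [cite: VoisinHodgeI2002, §11.3.3 Thm. 11.38, Thm. 11.40, p. 287,
§6.2.3 Thm. 6.25 and §7.3.1 Lemma 7.23] [cite: Deligne2000, §1] [cite: VoisinHodgeII2003, §9.2.4 Prop. 9.20] -/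
theorem BettiUniverse.hodgeConjectureFor_tensor_of_kunneth_pieces_le (hHD : exists_isReal_hodgeModel) (hY : IsSmoothProjective m Y) (hZ : IsSmoothProjective n Z) (hYZ : IsSmoothProjective d (Y ⊗ Z))
    (halg : ∀ (c i j : ℕ) (hij : i + j = 2 * c), i ≤ m → j ≤ n →
      ∀ t ∈ (BettiUniverse.kunnethSummand hHD hY hZ (2 * c) ⟨(i, j), HasAntidiagonal.mem_antidiagonal.2 hij⟩).hodgeClasses c,
        ofRatClass (ComplexPoints (Y ⊗ Z)) (2 * c) (BettiUniverse.crossMap Y Z hij t) ∈ algebraicClasses (Y ⊗ Z) c) :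
    HodgeConjectureFor d (Y ⊗ Z) := by
  -- pieces with `i ≤ m`, `j ≤ 2n`: reduce the second factor if `j > n`
  have hright : ∀ (c i j : ℕ) (hij : i + j = 2 * c), i ≤ m → j ≤ 2 * n →
      ∀ t ∈ (BettiUniverse.kunnethSummand hHD hY hZ (2 * c) ⟨(i, j), HasAntidiagonal.mem_antidiagonal.2 hij⟩).hodgeClasses c,
        ofRatClass (ComplexPoints (Y ⊗ Z)) (2 * c) (BettiUniverse.crossMap Y Z hij t) ∈ algebraicClasses (Y ⊗ Z) c := by
    intro c i j hij hi hj t ht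
    by_cases hjn : j ≤ n
    · exact halg c i j hij hi hjn t ht
    · -- `j = j₀ + 2s` with `j₀ + s = n`, `s = j − n`
      have hpar : (i + (2 * n - j)) % 2 = 0 := by omega
      exact BettiUniverse.ofRatClass_crossMap_mem_algebraicClasses_of_hardLefschetz_right hHD hY hZ hYZ (j₀ := 2 * n - j) (s := j - n) (c₀ := (i + (2 * n - j)) / 2) (by omega) (by omega)
        (by omega) hij (halg _ i (2 * n - j) (by omega) hi (by omega)) ht
  -- all pieces with `i ≤ 2m`, `j ≤ 2n`: reduce the first factor if `i > m`
  have hall : ∀ (c i j : ℕ) (hij : i + j = 2 * c), i ≤ 2 * m → j ≤ 2 * n →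
      ∀ t ∈ (BettiUniverse.kunnethSummand hHD hY hZ (2 * c) ⟨(i, j), HasAntidiagonal.mem_antidiagonal.2 hij⟩).hodgeClasses c,
        ofRatClass (ComplexPoints (Y ⊗ Z)) (2 * c) (BettiUniverse.crossMap Y Z hij t) ∈ algebraicClasses (Y ⊗ Z) c := by
    intro c i j hij hi hj t ht
    by_cases him : i ≤ m
    · exact hright c i j hij him hj t ht
    · have hpar : ((2 * m - i) + j) % 2 = 0 := by omega
      exact BettiUniverse.ofRatClass_crossMap_mem_algebraicClasses_of_hardLefschetz_left hHD hY hZ hYZ (i₀ := 2 * m - i) (s := i - m) (c₀ := ((2 * m - i) + j) / 2) (by omega) (by omega)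
        (by omega) hij (hright _ (2 * m - i) j (by omega) (by omega) hj) ht
  refine ⟨⟨BettiUniverse.realHodgeModel hHD hYZ⟩, fun c v hv hvH ↦ ?_⟩
  obtain ⟨w, rfl⟩ := (isRationalClass_iff_mem_range_ofRatClass v).1 hv
  have hw : w ∈ (BettiUniverse.hodge hHD hYZ (2 * c)).hodgeClasses c := (BettiUniverse.mem_hodgeClasses_hodge_iff_isOfHodgeType hHD hYZ c w).2 hvH
  obtain ⟨t, ⟨ht, rfl⟩, -⟩ := BettiUniverse.exists_eq_kunnethMap_of_mem_hodgeClasses hHD hodgePQ_independent_of_hodgeModel_holds hY hZ hYZ (2 * c) c hw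
  rw [map_sum]
  refine Submodule.sum_mem _ fun ij _ ↦ ?_
  obtain ⟨⟨i, j⟩, hij⟩ := ij
  have hij' : i + j = 2 * c := HasAntidiagonal.mem_antidiagonal.1 hij
  by_cases hi : i ≤ 2 * m
  · by_cases hj : j ≤ 2 * n
    · have h := hall c i j hij' hi hj _ (ht ⟨(i, j), hij⟩)
      exact h
    · have h := BettiUniverse.ofRatClass_crossMap_mem_algebraicClasses_of_lt hY hZ hij' (Or.inr (not_le.1 hj)) (t ⟨(i, j), hij⟩)
      exact h
  · have h := BettiUniverse.ofRatClass_crossMap_mem_algebraicClasses_of_lt hY hZ hij' (Or.inl (not_le.1 hi)) (t ⟨(i, j), hij⟩)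
    exact h

/-- **The piece `H⁰(Y) ⊗ H^{2c}(Z)` is governed by `HC^c(Z)`**: its Hodge classes are `H⁰(Y) ⊗ Hdg^c(H^{2c}(Z))` (`H⁰` is of pure type `(0,0)`, Deligne 2.1.13) and `pr₁^* e ∪ pr₂^* z` is algebraic for
`z ⊗ 1` algebraic (exterior products of algebraic classes are algebraic). [cite: VoisinHodgeI2002, §11.3.3 Thm. 11.38, p. 287] [cite: DeligneHodgeII1971, 2.1.13] [cite: VoisinHodgeII2003, §9.2.4 proof of Prop. 9.20] -/
theorem BettiUniverse.ofRatClass_crossMap_mem_algebraicClasses_of_fst_zero (hHD : exists_isReal_hodgeModel) (hY : IsSmoothProjective m Y) (hZ : IsSmoothProjective n Z) {j c : ℕ} (hc : 0 + j = 2 * c)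
    (hHC : ∀ z ∈ (BettiUniverse.hodge hHD hZ (2 * c)).hodgeClasses c, ofRatClass (ComplexPoints Z) (2 * c) z ∈ algebraicClasses Z c) {t : bettiCohomology Y 0 ⊗[ℚ] bettiCohomology Z j}
    (ht : t ∈ (BettiUniverse.kunnethSummand hHD hY hZ (2 * c) ⟨(0, j), HasAntidiagonal.mem_antidiagonal.2 hc⟩).hodgeClasses c) :
    ofRatClass (ComplexPoints (Y ⊗ Z)) (2 * c) (BettiUniverse.crossMap Y Z hc t) ∈ algebraicClasses (Y ⊗ Z) c := by
  obtain rfl : j = 2 * c := by omega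
  haveI := BettiUniverse.finite hY (2 * 0)
  have e0 : (BettiUniverse.hodge hHD hY (2 * 0)).hodgeClasses ((0 : ℕ) : ℤ) = ⊤ := BettiUniverse.hodgeClasses_hodge_zero_eq_top hHD hY
  have hspan := HodgeStructure.hodgeClasses_tensor_eq_span_of_hodgeClasses_eq_top (BettiUniverse.hodge hHD hY (2 * 0)) e0 (by norm_num) (BettiUniverse.hodge hHD hZ (2 * c)) (c : ℤ)
  rw [show (((0 : ℕ) : ℤ)) + (c : ℤ) = c by push_cast; ring] at hspan
  have hle : Submodule.span ℚ (Set.image2 (fun u w ↦ u ⊗ₜ[ℚ] w) Set.univ (((BettiUniverse.hodge hHD hZ (2 * c)).hodgeClasses c : Set (bettiCohomology Z (2 * c))))) ≤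
      LinearMap.range (TensorProduct.mapIncl (⊤ : Submodule ℚ (bettiCohomology Y (2 * 0))) ((BettiUniverse.hodge hHD hZ (2 * c)).hodgeClasses c)) :=
    Submodule.span_le.2 (by
      rintro _ ⟨u, -, w, hw, rfl⟩
      exact ⟨(⟨u, Submodule.mem_top⟩ : ↥(⊤ : Submodule ℚ (bettiCohomology Y (2 * 0)))) ⊗ₜ[ℚ] (⟨w, hw⟩ : ↥((BettiUniverse.hodge hHD hZ (2 * c)).hodgeClasses c)),
        by rw [TensorProduct.mapIncl, TensorProduct.map_tmul]; rfl⟩)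
  have ht' : t ∈ LinearMap.range (TensorProduct.mapIncl (⊤ : Submodule ℚ (bettiCohomology Y (2 * 0))) ((BettiUniverse.hodge hHD hZ (2 * c)).hodgeClasses c)) := by
    refine hle ?_
    rw [← hspan]
    change t ∈ (((BettiUniverse.hodge hHD hY 0).tensor (BettiUniverse.hodge hHD hZ (2 * c))).cast _).hodgeClasses _ at ht
    rw [HodgeStructure.cast_hodgeClasses] at ht
    exact ht
  obtain ⟨w, rfl⟩ := ht'
  clear ht
  induction w using TensorProduct.induction_on with
  | zero => rw [map_zero, map_zero, map_zero]; exact Submodule.zero_mem _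
  | tmul p q =>
    rw [TensorProduct.mapIncl, TensorProduct.map_tmul, Submodule.subtype_apply, Submodule.subtype_apply, BettiUniverse.crossMap_tmul, BettiUniverse.ofRatClass_bettiCup, BettiUniverse.ofRatClass_pull,
      BettiUniverse.ofRatClass_pull]
    have hp : ofRatClass (ComplexPoints Y) (2 * 0) (p : bettiCohomology Y (2 * 0)) ∈ algebraicClasses Y 0 := by rw [algebraicClasses_zero]; exact Submodule.mem_top
    have H := cupProduct_map_fst_map_snd_mem_supportedClasses hY hZ hc hp (hHC q q.2)
    rw [Nat.zero_add] at H
    exact H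
  | add x y hx hy => rw [map_add, map_add, map_add]; exact Submodule.add_mem _ hx hy

/-- **The piece `H^{2c}(Y) ⊗ H⁰(Z)` is governed by `HC^c(Y)`** (the mirror statement). [cite: VoisinHodgeI2002, §11.3.3 Thm. 11.38, p. 287] [cite: DeligneHodgeII1971, 2.1.13] [cite: VoisinHodgeII2003, §9.2.4 proof of Prop. 9.20] -/
theorem BettiUniverse.ofRatClass_crossMap_mem_algebraicClasses_of_snd_zero (hHD : exists_isReal_hodgeModel) (hY : IsSmoothProjective m Y) (hZ : IsSmoothProjective n Z) {i c : ℕ} (hc : i + 0 = 2 * c)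
    (hHC : ∀ y ∈ (BettiUniverse.hodge hHD hY (2 * c)).hodgeClasses c, ofRatClass (ComplexPoints Y) (2 * c) y ∈ algebraicClasses Y c) {t : bettiCohomology Y i ⊗[ℚ] bettiCohomology Z 0}
    (ht : t ∈ (BettiUniverse.kunnethSummand hHD hY hZ (2 * c) ⟨(i, 0), HasAntidiagonal.mem_antidiagonal.2 hc⟩).hodgeClasses c) :
    ofRatClass (ComplexPoints (Y ⊗ Z)) (2 * c) (BettiUniverse.crossMap Y Z hc t) ∈ algebraicClasses (Y ⊗ Z) c := by
  obtain rfl : i = 2 * c := by omega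
  haveI := BettiUniverse.finite hZ (2 * 0)
  have e0 : (BettiUniverse.hodge hHD hZ (2 * 0)).hodgeClasses ((0 : ℕ) : ℤ) = ⊤ := BettiUniverse.hodgeClasses_hodge_zero_eq_top hHD hZ
  have hspan := HodgeStructure.hodgeClasses_tensor_eq_span_of_hodgeClasses_eq_top_right (BettiUniverse.hodge hHD hY (2 * c)) (c : ℤ) (BettiUniverse.hodge hHD hZ (2 * 0)) e0 (by norm_num)
  rw [show (c : ℤ) + (((0 : ℕ) : ℤ)) = c by push_cast; ring] at hspan
  have hle : Submodule.span ℚ (Set.image2 (fun w u ↦ w ⊗ₜ[ℚ] u) (((BettiUniverse.hodge hHD hY (2 * c)).hodgeClasses c : Set (bettiCohomology Y (2 * c)))) Set.univ) ≤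
      LinearMap.range (TensorProduct.mapIncl ((BettiUniverse.hodge hHD hY (2 * c)).hodgeClasses c) (⊤ : Submodule ℚ (bettiCohomology Z (2 * 0)))) :=
    Submodule.span_le.2 (by
      rintro _ ⟨w, hw, u, -, rfl⟩
      exact ⟨(⟨w, hw⟩ : ↥((BettiUniverse.hodge hHD hY (2 * c)).hodgeClasses c)) ⊗ₜ[ℚ] (⟨u, Submodule.mem_top⟩ : ↥(⊤ : Submodule ℚ (bettiCohomology Z (2 * 0)))),
        by rw [TensorProduct.mapIncl, TensorProduct.map_tmul]; rfl⟩)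
  have ht' : t ∈ LinearMap.range (TensorProduct.mapIncl ((BettiUniverse.hodge hHD hY (2 * c)).hodgeClasses c) (⊤ : Submodule ℚ (bettiCohomology Z (2 * 0)))) := by
    refine hle ?_
    rw [← hspan]
    change t ∈ (((BettiUniverse.hodge hHD hY (2 * c)).tensor (BettiUniverse.hodge hHD hZ 0)).cast _).hodgeClasses _ at ht
    rw [HodgeStructure.cast_hodgeClasses] at ht
    exact ht
  obtain ⟨w, rfl⟩ := ht'
  clear ht
  induction w using TensorProduct.induction_on with
  | zero => rw [map_zero, map_zero, map_zero]; exact Submodule.zero_mem _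
  | tmul p q =>
    rw [TensorProduct.mapIncl, TensorProduct.map_tmul, Submodule.subtype_apply, Submodule.subtype_apply, BettiUniverse.crossMap_tmul, BettiUniverse.ofRatClass_bettiCup, BettiUniverse.ofRatClass_pull,
      BettiUniverse.ofRatClass_pull]
    have hq : ofRatClass (ComplexPoints Z) (2 * 0) (q : bettiCohomology Z (2 * 0)) ∈ algebraicClasses Z 0 := by rw [algebraicClasses_zero]; exact Submodule.mem_top
    have H := cupProduct_map_fst_map_snd_mem_supportedClasses hY hZ hc (hHC p p.2) hq
    exact H
  | add x y hx hy => rw [map_add, map_add, map_add]; exact Submodule.add_mem _ hx hy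

/-- **THE ASSEMBLY, refined form: `HC(Y × Z)` ⟸ `HC(Y)`, `HC(Z)` and the algebraicity of the Hodge classes of the pieces `Hⁱ(Y) ⊗ Hʲ(Z)` with `1 ≤ i ≤ dim Y`, `1 ≤ j ≤ dim Z`, `i + j = 2c ≥ 4`** —
unconditionally (the pieces with `i = 0` or `j = 0` are governed by `HC(Z)`, `HC(Y)`; total degree `2` is Lefschetz `(1,1)`).  For instance the conditions are void when `dim Y = 1` (`HC(C × Z) ⟸ HC(Z)` needs
the pieces `H¹(C) ⊗ H^{2c−1}(Z)`, `3 ≤ 2c − 1 ≤ dim Z` — see the lane's `BettiHodgeClassesProductWithCurve`). [cite: VoisinHodgeI2002, §11.3.3 Thm. 11.38, Thm. 11.40, Lemma 11.41, p. 287, §11.3.1 Thm. 11.30, §6.2.3 Thm. 6.25]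
[cite: Deligne2000, §1] [cite: VoisinHodgeII2003, §9.2.4 Prop. 9.20] -/
theorem BettiUniverse.hodgeConjectureFor_tensor_of_kunneth_pieces_pos_le (hHD : exists_isReal_hodgeModel) (hY : IsSmoothProjective m Y) (hZ : IsSmoothProjective n Z) (hYZ : IsSmoothProjective d (Y ⊗ Z))
    (hHCY : HodgeConjectureFor m Y) (hHCZ : HodgeConjectureFor n Z)
    (halg : ∀ (c i j : ℕ) (hij : i + j = 2 * c), 1 ≤ i → i ≤ m → 1 ≤ j → j ≤ n → 2 ≤ c →
      ∀ t ∈ (BettiUniverse.kunnethSummand hHD hY hZ (2 * c) ⟨(i, j), HasAntidiagonal.mem_antidiagonal.2 hij⟩).hodgeClasses c,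
        ofRatClass (ComplexPoints (Y ⊗ Z)) (2 * c) (BettiUniverse.crossMap Y Z hij t) ∈ algebraicClasses (Y ⊗ Z) c) :
    HodgeConjectureFor d (Y ⊗ Z) := by
  refine BettiUniverse.hodgeConjectureFor_tensor_of_kunneth_pieces_le hHD hY hZ hYZ fun c i j hij hi hj t ht ↦ ?_
  by_cases hc1 : c ≤ 1
  · exact BettiUniverse.ofRatClass_crossMap_mem_algebraicClasses_of_lefschetzRange hHD hY hZ hYZ hij (Or.inl hc1) ht
  rcases Nat.eq_zero_or_pos i with rfl | hi1
  · exact BettiUniverse.ofRatClass_crossMap_mem_algebraicClasses_of_fst_zero hHD hY hZ hij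
      (fun z hz ↦ hHCZ.2 c _ (isRationalClass_ofRatClass _) ((BettiUniverse.mem_hodgeClasses_hodge_iff_isOfHodgeType hHD hZ c z).1 hz)) ht
  rcases Nat.eq_zero_or_pos j with rfl | hj1
  · exact BettiUniverse.ofRatClass_crossMap_mem_algebraicClasses_of_snd_zero hHD hY hZ hij
      (fun y hy ↦ hHCY.2 c _ (isRationalClass_ofRatClass _) ((BettiUniverse.mem_hodgeClasses_hodge_iff_isOfHodgeType hHD hY c y).1 hy)) ht
  exact halg c i j hij hi1 hi hj1 hj (by omega) t ht

end Reduction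

/-! ### §5 The pieces `H¹(Y) ⊗ H^{2n−1}(Z)` and `H^{2m−1}(Y) ⊗ H¹(Z)` are algebraic for all smooth projective `Y`, `Z` -/

section OddPieces

variable [HodgeTensorFacts.{0, 0}]

/-- **The Hodge classes of the Künneth piece `H¹(Y) ⊗ H^{2n−1}(Z)` of `H^{2n}(Y × Z)` (`n = dim Z ≥ 1`) are algebraic, for ALL smooth projective `Y`, `Z`**: by `L^{n−1}_η : H¹(Z) ⥲ H^{2n−1}(Z)(n−1)` the
piece reduces to `H¹(Y) ⊗ H¹(Z) ⊂ H²(Y × Z)`, whose Hodge classes are divisor classes (Lefschetz `(1,1)`); the classes in question are `(pr₂^* η)^{n−1} ∪ D` with `D` a divisor class of `Y × Z`.  The case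
`n = 2` is g28-#7 / g29-#1. [cite: VoisinHodgeI2002, §6.2.3 Thm. 6.25, Rem. 6.27, §11.3.1 Thm. 11.30, §11.3.3 Thm. 11.38–11.40 and p. 287] [cite: VoisinHodgeII2003, §9.2.4 Prop. 9.20] [cite: Voisin2013GHCBloch, Lemma 2.1 (proof)] -/
theorem BettiUniverse.ofRatClass_crossMap_mem_algebraicClasses_one_tensor_top_sub_one (hHD : exists_isReal_hodgeModel) (hY : IsSmoothProjective m Y) (hZ : IsSmoothProjective n Z)
    (hYZ : IsSmoothProjective d (Y ⊗ Z)) {j : ℕ} (hj : j + 1 = 2 * n) (hc : 1 + j = 2 * n) {t : bettiCohomology Y 1 ⊗[ℚ] bettiCohomology Z j}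
    (ht : t ∈ (BettiUniverse.kunnethSummand hHD hY hZ (2 * n) ⟨(1, j), HasAntidiagonal.mem_antidiagonal.2 hc⟩).hodgeClasses n) :
    ofRatClass (ComplexPoints (Y ⊗ Z)) (2 * n) (BettiUniverse.crossMap Y Z hc t) ∈ algebraicClasses (Y ⊗ Z) n :=
  BettiUniverse.ofRatClass_crossMap_mem_algebraicClasses_of_hardLefschetz_right hHD hY hZ hYZ (j₀ := 1) (s := n - 1) (c₀ := 1) (by omega) (by omega) rfl hc
    (fun _ hu ↦ BettiUniverse.ofRatClass_crossMap_mem_algebraicClasses_of_lefschetzRange hHD hY hZ hYZ rfl (Or.inl le_rfl) hu) ht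

/-- **The Hodge classes of the Künneth piece `H^{2m−1}(Y) ⊗ H¹(Z)` of `H^{2m}(Y × Z)` (`m = dim Y ≥ 1`) are algebraic, for ALL smooth projective `Y`, `Z`** (the mirror statement).
[cite: VoisinHodgeI2002, §6.2.3 Thm. 6.25, Rem. 6.27, §11.3.1 Thm. 11.30, §11.3.3 Thm. 11.38–11.40 and p. 287] [cite: VoisinHodgeII2003, §9.2.4 Prop. 9.20] [cite: Voisin2013GHCBloch, Lemma 2.1 (proof)] -/
theorem BettiUniverse.ofRatClass_crossMap_mem_algebraicClasses_top_sub_one_tensor_one (hHD : exists_isReal_hodgeModel) (hY : IsSmoothProjective m Y) (hZ : IsSmoothProjective n Z)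
    (hYZ : IsSmoothProjective d (Y ⊗ Z)) {i : ℕ} (hi : i + 1 = 2 * m) (hc : i + 1 = 2 * m) {t : bettiCohomology Y i ⊗[ℚ] bettiCohomology Z 1}
    (ht : t ∈ (BettiUniverse.kunnethSummand hHD hY hZ (2 * m) ⟨(i, 1), HasAntidiagonal.mem_antidiagonal.2 hc⟩).hodgeClasses m) :
    ofRatClass (ComplexPoints (Y ⊗ Z)) (2 * m) (BettiUniverse.crossMap Y Z hc t) ∈ algebraicClasses (Y ⊗ Z) m :=
  BettiUniverse.ofRatClass_crossMap_mem_algebraicClasses_of_hardLefschetz_left hHD hY hZ hYZ (i₀ := 1) (s := m - 1) (c₀ := 1) (by omega) (by omega) rfl hc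
    (fun _ hu ↦ BettiUniverse.ofRatClass_crossMap_mem_algebraicClasses_of_lefschetzRange hHD hY hZ hYZ rfl (Or.inl le_rfl) hu) ht

/-- **More generally, every piece `Hⁱ(Y) ⊗ Hʲ(Z)` with `dim Z ≤ j ≤ 2 dim Z` whose reduction `Hⁱ(Y) ⊗ H^{2 dim Z − j}(Z)` has total degree `≤ 2` is algebraic** (the reduced piece lies in the
Lefschetz `(1,1)` range): e.g. `(1, 2n−1)`, `(0, 2n)`, `(0, 2n−2)`, `(2, 2n)` for `n = dim Z`. [cite: VoisinHodgeI2002, §6.2.3 Thm. 6.25, §11.3.1 Thm. 11.30 and §11.3.3 p. 287] [cite: VoisinHodgeII2003, §9.2.4 Prop. 9.20] -/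
theorem BettiUniverse.ofRatClass_crossMap_mem_algebraicClasses_of_reduces_to_le_two_right (hHD : exists_isReal_hodgeModel) (hY : IsSmoothProjective m Y) (hZ : IsSmoothProjective n Z)
    (hYZ : IsSmoothProjective d (Y ⊗ Z)) {i j c : ℕ} (hc : i + j = 2 * c) (hjn : n ≤ j) (hj2 : j ≤ 2 * n) (hsmall : i + (2 * n - j) ≤ 2) {t : bettiCohomology Y i ⊗[ℚ] bettiCohomology Z j}
    (ht : t ∈ (BettiUniverse.kunnethSummand hHD hY hZ (2 * c) ⟨(i, j), HasAntidiagonal.mem_antidiagonal.2 hc⟩).hodgeClasses c) :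
    ofRatClass (ComplexPoints (Y ⊗ Z)) (2 * c) (BettiUniverse.crossMap Y Z hc t) ∈ algebraicClasses (Y ⊗ Z) c := by
  have hpar : (i + (2 * n - j)) % 2 = 0 := by omega
  exact BettiUniverse.ofRatClass_crossMap_mem_algebraicClasses_of_hardLefschetz_right hHD hY hZ hYZ (j₀ := 2 * n - j) (s := j - n) (c₀ := (i + (2 * n - j)) / 2) (by omega) (by omega)
    (by omega) hc (fun _ hu ↦ BettiUniverse.ofRatClass_crossMap_mem_algebraicClasses_of_lefschetzRange hHD hY hZ hYZ _ (Or.inl (by omega)) hu) ht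

end OddPieces

end Literature.AlgebraicGeometry.HodgeTheory

end
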